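import Summits.QuantumFields.YangMills.Theorems.AllWindowsColdBoxBoxHighLinePhiQuarticMoments
import Summits.QuantumFields.YangMills.Theorems.AllWindowsColdBoxBoxHighLineQuarticVertexColdBox
import Summits.QuantumFields.YangMills.Theorems.AllWindowsColdBoxBoxHighLineCubeTwoCentreSums
import Summits.QuantumFields.YangMills.Theorems.AllWindowsColdBoxBoxHighLineCum3TriangleMuSet
import Summits.QuantumFields.YangMills.Theorems.AllWindowsColdBoxBoxHighLineRestrictionSetCum3Slots

/-!
# K3′ row «E1-Φ»: the EXACT connected row of two plaquette forms against the `Φ⁴` vertex `phiQuartic`, under `E₀` and ON THE CUT SET `μ_{D′}`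
# (planner ym-idea-2 g18's ruling 2026-08-30T01:19:49Z ★FLAG-1 = fcl-p3 g27's Q8 table row (c); `Cruxes/BoxWindowHighSU2213/ASSEMBLY-U5.md` §8; U5 ⟨stmt-QuantumFields-24336⟩)

Width seat `ym-line-sfw-p2-w2` (g33).  The even vertex `U_Φ = −β(Φ − divLinSq)` of the tilt exponent contributes, beyond its sextic Taylor tail (✓`phiTaylor`,
a sup×L² row), the QUARTIC piece `−β·phiQuartic`, whose sup×L² row fails in the HIGH window (`[11θ − 1/2]`); this is its EXACT row, K uniform in `p q D`:
* §5 (`PhiQuartic`, under `E₀`): the connected functional `Z ↦ E₀[WZ] − E₀W·E₀Z` is linear (`gaussAvg_mul_centred_eq`, `conn_sum_eq`, `conn_const_mul_eq`);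
  `abs_conn_monomial_le` = w3 g41's ✓`WickPairCubic.abs_gaussAvg_centredLandauForms_mul_four_connected_le` in `linCurvSq` letters (bridge
  ✓`Cum3Triangle.linCurvSq_sub_gaussAvg_eq_centredForm`); ★`abs_conn_phiSite_le` (the 576 signed local monomials of ✓`phiSite_eq_sum_monomials`: `≤ 192×` the
  monomial size); ★★`abs_gaussAvg_centred_linCurvSq_linCurvSq_phiQuartic_le`: `|E₀[(L_p − E₀L_p)(L_q − E₀L_q)(Φ₄ − E₀Φ₄)]| ≤ β⁻¹^4·C·(1+log H)⁵` uniformly in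
  `p q` (site sums over `interiorSites H ⊆ [0,2H]⁴` by ✓`cubeTwoCentreSums` (2,2));
* §6 (`GaussRestrict`, on `μ_D`, `D ⊆ smallField H s` measurable, `E₀[1 − 1_D] ≤ τ ≤ 1/2`): ★★`abs_tiltCum3_muSet_linCurvSq_linCurvSq_phiQuartic_le`:
  `|Tilt.tiltCum3 μ_D (phiQuartic H) 0 L_{(x,μ₁,ν₁)} L_{(y,μ₂,ν₂)}| ≤ β⁻¹^4·C·(1+log H)⁵·(1 + √τ·H⁴)` (fcl-p3 g27's ✓`abs_tiltCum3_muSet_zero_sub_gaussAvg_centred_le`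
  with perfect-square Bonami–Nelson sizes), and `…_const_mul_phiQuartic_le` for the vertex `c·phiQuartic` (bound `|c|×…`; the hK3 row-sum takes `c = −β`).
EXPONENT ROW at `κ₃ = 1/8 − θ/4`, `c = −β` (relative size `β²H⁸ × row`): `E₀`-part `H⁸(1+log H)⁵/β` — `[8θ − 1] < 0` (`θ < 1/8`); `√τ`-part
`H¹²(1+log H)⁵β^{−1−q/2}` (`τ = β^{−q}`) — `[12θ − 1 − q/2] < 0` for `q ≥ 1` on the whole window `θ < 1/10` (the hKk q-slot is free).

Tree only; no definitions; standard axioms.  HONEST LABEL: U5 prep, helper-grade (ONE row of the hK3′ row-sum; the other rows and the sum are other seats');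
U5 ⟨24336⟩ UNSTAFFED/OPEN, ⟨24004⟩ OPEN; route AllWindowsColdBox DRAFT; no crux, rung or summit is proved; **the Yang–Mills mass gap is NOT proved by this file;
no summit is proved by a line.**
-/

set_option autoImplicit false

noncomputable section

open MeasureTheory Matrix Finset
open Literature.Probability.LatticeModels (Site)
open Literature.MathematicalPhysics.QuantumFieldTheory (Plaq)

namespace Summit.QuantumFields.YangMills.Theorems.AllWindowsColdBoxBoxHighLine

namespace PhiQuartic

open EdgeChartGaussian (polyCert_const polyCert_coord polyCert_sub polyCert_mul polyCert_pow polyCert_sum polyCert_const_mul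
  gaussAvg_sq_mul_sq_le_of_polyCert integrable_polyCert_mul_gaussWeight)
open LaplaceSandwich (flatten)

variable {H : ℕ} {β : ℝ}

/-! ## §5 The `E₀`-exact connected row `E₀[(L_p − E₀L_p)(L_q − E₀L_q)(Φ₄ − E₀Φ₄)]` -/

/-- The centred third slot: `E₀[W·(Z − E₀Z)] = E₀[WZ] − E₀W·E₀Z` for certified polynomial observables. -/
theorem gaussAvg_mul_centred_eq (hβ : 0 < β) {W Z : (LandauFree H → E3) → ℝ} {dW dZ : ℕ}
    (hW : ∃ Q : MvPolynomial (LandauFree H × Fin 3) ℝ, Q.totalDegree ≤ dW ∧ ∀ a, W a = MvPolynomial.eval (flatten (LandauFree H) a) Q)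
    (hZ : ∃ Q : MvPolynomial (LandauFree H × Fin 3) ℝ, Q.totalDegree ≤ dZ ∧ ∀ a, Z a = MvPolynomial.eval (flatten (LandauFree H) a) Q) :
    gaussAvg β H (fun a => W a * (Z a - gaussAvg β H Z)) = gaussAvg β H (fun a => W a * Z a) - gaussAvg β H W * gaussAvg β H Z := by
  have h : (fun a => W a * (Z a - gaussAvg β H Z)) = fun a => W a * Z a + (-gaussAvg β H Z) * W a := by funext a; ring
  rw [h, EdgeChartGaussian.gaussAvg_add β H (integrable_polyCert_mul_gaussWeight H hβ (polyCert_mul hW hZ))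
    (integrable_polyCert_mul_gaussWeight H hβ (polyCert_const_mul _ hW)), EdgeChartGaussian.gaussAvg_const_mul]
  ring

/-- The connected functional `Z ↦ E₀[WZ] − E₀W·E₀Z` is additive over finite sums of certified polynomial observables. -/
theorem conn_sum_eq (hβ : 0 < β) {ι : Type*} (s : Finset ι) {W : (LandauFree H → E3) → ℝ} {Z : ι → (LandauFree H → E3) → ℝ} {dW dZ : ℕ}
    (hW : ∃ Q : MvPolynomial (LandauFree H × Fin 3) ℝ, Q.totalDegree ≤ dW ∧ ∀ a, W a = MvPolynomial.eval (flatten (LandauFree H) a) Q)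
    (hZ : ∀ i ∈ s, ∃ Q : MvPolynomial (LandauFree H × Fin 3) ℝ, Q.totalDegree ≤ dZ ∧ ∀ a, Z i a = MvPolynomial.eval (flatten (LandauFree H) a) Q) :
    gaussAvg β H (fun a => W a * ∑ i ∈ s, Z i a) - gaussAvg β H W * gaussAvg β H (fun a => ∑ i ∈ s, Z i a) =
      ∑ i ∈ s, (gaussAvg β H (fun a => W a * Z i a) - gaussAvg β H W * gaussAvg β H (Z i)) := by
  have h1 : gaussAvg β H (fun a => W a * ∑ i ∈ s, Z i a) = ∑ i ∈ s, gaussAvg β H (fun a => W a * Z i a) := by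
    have : (fun a => W a * ∑ i ∈ s, Z i a) = fun a => ∑ i ∈ s, W a * Z i a := by funext a; rw [Finset.mul_sum]
    rw [this]
    exact EdgeChartGaussian.gaussAvg_finset_sum β H s (fun i a => W a * Z i a) fun i hi =>
      integrable_polyCert_mul_gaussWeight H hβ (polyCert_mul hW (hZ i hi))
  have h2 : gaussAvg β H (fun a => ∑ i ∈ s, Z i a) = ∑ i ∈ s, gaussAvg β H (Z i) :=
    EdgeChartGaussian.gaussAvg_finset_sum β H s Z fun i hi => integrable_polyCert_mul_gaussWeight H hβ (hZ i hi)
  rw [h1, h2, Finset.mul_sum, ← Finset.sum_sub_distrib]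

/-- The connected functional is homogeneous in the third slot. -/
theorem conn_const_mul_eq (β : ℝ) (H : ℕ) (W Z : (LandauFree H → E3) → ℝ) (κ : ℝ) :
    gaussAvg β H (fun a => W a * (κ * Z a)) - gaussAvg β H W * gaussAvg β H (fun a => κ * Z a) =
      κ * (gaussAvg β H (fun a => W a * Z a) - gaussAvg β H W * gaussAvg β H Z) := by
  have h : (fun a => W a * (κ * Z a)) = fun a => κ * (W a * Z a) := by funext a; ring
  rw [h, EdgeChartGaussian.gaussAvg_const_mul, EdgeChartGaussian.gaussAvg_const_mul]
  ring

/-- **w3 g41's quartic-monomial connected size in `linCurvSq` letters** (✓`WickPairCubic.abs_gaussAvg_centredLandauForms_mul_four_connected_le` through the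
bridge ✓`Cum3Triangle.linCurvSq_sub_gaussAvg_eq_centredForm`): for a quartic monomial with legs within sup-distance `1` of `x`,
`|E₀[L̃_pL̃_qN] − E₀[L̃_pL̃_q]E₀[N]| ≤ β⁻⁴·C·(1+log H)⁴·[(1+d(x,p))⁻⁶(1+d(x,q))⁻⁶ + (1+‖p−q‖₁)⁻⁴(1+d(x,p))⁻³(1+d(x,q))⁻³]`. -/
theorem abs_conn_monomial_le : ∃ C : ℝ, 0 ≤ C ∧ ∀ H : ℕ, 1 ≤ H → ∀ β : ℝ, 0 < β →
    ∀ (p q : Plaq 4) (x : Site 4) (n₀ n₁ n₂ n₃ : LandauFree H × Fin 3),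
    (∀ s : Fin 4, ∀ k : Fin 4, |((((![n₀, n₁, n₂, n₃] s).1.1.1.1 k - x k : ℤ)) : ℝ)| ≤ 1) →
    |gaussAvg β H (fun a => (linCurvSq H p a - gaussAvg β H (linCurvSq H p)) * (linCurvSq H q a - gaussAvg β H (linCurvSq H q)) *
          (a n₀.1 n₀.2 * a n₁.1 n₁.2 * a n₂.1 n₂.2 * a n₃.1 n₃.2)) -
        gaussAvg β H (fun a => (linCurvSq H p a - gaussAvg β H (linCurvSq H p)) * (linCurvSq H q a - gaussAvg β H (linCurvSq H q))) *
          gaussAvg β H (fun a => a n₀.1 n₀.2 * a n₁.1 n₁.2 * a n₂.1 n₂.2 * a n₃.1 n₃.2)| ≤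
      β⁻¹ ^ 4 * (C * (1 + Real.log H) ^ 4 * (1 / ((1 + siteDist x p.1) ^ 6 * (1 + siteDist x q.1) ^ 6) +
        1 / ((1 + (((∑ m : Fin 4, |p.1 m - q.1 m|) : ℤ) : ℝ)) ^ 4 * (1 + siteDist x p.1) ^ 3 * (1 + siteDist x q.1) ^ 3))) := by
  obtain ⟨C, hC0, hW⟩ := WickPairCubic.abs_gaussAvg_centredLandauForms_mul_four_connected_le
  refine ⟨C, hC0, fun H hH β hβ p q x n₀ n₁ n₂ n₃ hlegs => ?_⟩
  have key := hW H hH β hβ p q (fun i j => (2 * β)⁻¹ * if i.2 = j.2 then (hodgeQ H)⁻¹ i.1 j.1 else 0)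
    (fun i j => if i.2 = j.2 then landauCoeff H p i.1 * landauCoeff H p j.1 else 0)
    (fun i j => if i.2 = j.2 then landauCoeff H q i.1 * landauCoeff H q j.1 else 0) (fun i j => rfl) (fun i j => rfl) (fun i j => rfl)
    x n₀ n₁ n₂ n₃ hlegs
  have hp := Cum3Triangle.linCurvSq_sub_gaussAvg_eq_centredForm H hβ p (fun i j => (2 * β)⁻¹ * if i.2 = j.2 then (hodgeQ H)⁻¹ i.1 j.1 else 0)
    (fun i j => if i.2 = j.2 then landauCoeff H p i.1 * landauCoeff H p j.1 else 0) (fun i j => rfl) (fun i j => rfl)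
  have hq := Cum3Triangle.linCurvSq_sub_gaussAvg_eq_centredForm H hβ q (fun i j => (2 * β)⁻¹ * if i.2 = j.2 then (hodgeQ H)⁻¹ i.1 j.1 else 0)
    (fun i j => if i.2 = j.2 then landauCoeff H q i.1 * landauCoeff H q j.1 else 0) (fun i j => rfl) (fun i j => rfl)
  simp_rw [hp, hq]
  exact key

/-- ★ **The site row**: at an interior site `x`, the connected size of `L̃_p, L̃_q` against the site term of `phiQuartic` is at most `192` times the
monomial size (`576` signed monomials of modulus `1/3`, all local at `x`). -/
theorem abs_conn_phiSite_le : ∃ C : ℝ, 0 ≤ C ∧ ∀ H : ℕ, 1 ≤ H → ∀ β : ℝ, 0 < β → ∀ (p q : Plaq 4) (x : Site 4), x ∈ interiorSites H →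
    |gaussAvg β H (fun a => (linCurvSq H p a - gaussAvg β H (linCurvSq H p)) * (linCurvSq H q a - gaussAvg β H (linCurvSq H q)) *
          (-(1 / 3 : ℝ) * ∑ c : Fin 3, divLin H x a c * divLin H x (cubeField a) c)) -
        gaussAvg β H (fun a => (linCurvSq H p a - gaussAvg β H (linCurvSq H p)) * (linCurvSq H q a - gaussAvg β H (linCurvSq H q))) *
          gaussAvg β H (fun a => -(1 / 3 : ℝ) * ∑ c : Fin 3, divLin H x a c * divLin H x (cubeField a) c)| ≤
      192 * (β⁻¹ ^ 4 * (C * (1 + Real.log H) ^ 4 * (1 / ((1 + siteDist x p.1) ^ 6 * (1 + siteDist x q.1) ^ 6) +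
        1 / ((1 + (((∑ m : Fin 4, |p.1 m - q.1 m|) : ℤ) : ℝ)) ^ 4 * (1 + siteDist x p.1) ^ 3 * (1 + siteDist x q.1) ^ 3)))) := by
  obtain ⟨C, hC0, hmono⟩ := abs_conn_monomial_le
  refine ⟨C, hC0, fun H hH β hβ p q x hx => ?_⟩
  have hcL : ∀ r : Plaq 4, ∃ Q : MvPolynomial (LandauFree H × Fin 3) ℝ, Q.totalDegree ≤ 2 ∧
      ∀ a, linCurvSq H r a - gaussAvg β H (linCurvSq H r) = MvPolynomial.eval (flatten (LandauFree H) a) Q := fun r =>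
    polyCert_sub (EdgeChartGaussian.polyCert_linCurvSq H r) (polyCert_const _ 2)
  have hW := polyCert_mul (hcL p) (hcL q)
  -- the site term as a sum of signed local monomials
  have hφ : ∀ a : LandauFree H → E3, -(1 / 3 : ℝ) * ∑ c : Fin 3, divLin H x a c * divLin H x (cubeField a) c =
      ∑ i : Fin 3 × (Fin 4 ⊕ Fin 4) × (Fin 4 ⊕ Fin 4) × Fin 3,
        (-(1 / 3 : ℝ) * (Sum.elim (fun _ => (1 : ℝ)) (fun _ => -1) i.2.1 * Sum.elim (fun _ => (1 : ℝ)) (fun _ => -1) i.2.2.1)) *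
          (a (Sum.elim (inEdge hx) (outEdge hx) i.2.1) i.1 * a (Sum.elim (inEdge hx) (outEdge hx) i.2.2.1) i.1 *
            a (Sum.elim (inEdge hx) (outEdge hx) i.2.2.1) i.2.2.2 * a (Sum.elim (inEdge hx) (outEdge hx) i.2.2.1) i.2.2.2) := by
    intro a
    rw [phiSite_eq_sum_monomials hx]
    refine Finset.sum_congr rfl fun i _ => ?_
    simp only [mul_assoc]
  have hZ : ∀ i ∈ (Finset.univ : Finset (Fin 3 × (Fin 4 ⊕ Fin 4) × (Fin 4 ⊕ Fin 4) × Fin 3)),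
      ∃ Q : MvPolynomial (LandauFree H × Fin 3) ℝ, Q.totalDegree ≤ 1 + 1 + 1 + 1 ∧ ∀ a : LandauFree H → E3,
        (-(1 / 3 : ℝ) * (Sum.elim (fun _ => (1 : ℝ)) (fun _ => -1) i.2.1 * Sum.elim (fun _ => (1 : ℝ)) (fun _ => -1) i.2.2.1)) *
          (a (Sum.elim (inEdge hx) (outEdge hx) i.2.1) i.1 * a (Sum.elim (inEdge hx) (outEdge hx) i.2.2.1) i.1 *
            a (Sum.elim (inEdge hx) (outEdge hx) i.2.2.1) i.2.2.2 * a (Sum.elim (inEdge hx) (outEdge hx) i.2.2.1) i.2.2.2) =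
        MvPolynomial.eval (flatten (LandauFree H) a) Q := fun i _ =>
    polyCert_const_mul _ (polyCert_mul (polyCert_mul (polyCert_mul (polyCert_coord _ _ le_rfl) (polyCert_coord _ _ le_rfl))
      (polyCert_coord _ _ le_rfl)) (polyCert_coord _ _ le_rfl))
  simp_rw [hφ]
  rw [conn_sum_eq hβ _ hW hZ]
  refine (Finset.abs_sum_le_sum_abs _ _).trans ?_
  refine (Finset.sum_le_sum (g := fun _ => (1 / 3 : ℝ) * (β⁻¹ ^ 4 * (C * (1 + Real.log H) ^ 4 *
    (1 / ((1 + siteDist x p.1) ^ 6 * (1 + siteDist x q.1) ^ 6) +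
      1 / ((1 + (((∑ m : Fin 4, |p.1 m - q.1 m|) : ℤ) : ℝ)) ^ 4 * (1 + siteDist x p.1) ^ 3 * (1 + siteDist x q.1) ^ 3))))) fun i _ => ?_).trans
    (le_of_eq ?_)
  · rw [conn_const_mul_eq, abs_mul]
    have hκ : |(-(1 / 3 : ℝ) * (Sum.elim (fun _ => (1 : ℝ)) (fun _ => -1) i.2.1 * Sum.elim (fun _ => (1 : ℝ)) (fun _ => -1) i.2.2.1))| = 1 / 3 := by
      rcases i.2.1 with μ | μ <;> rcases i.2.2.1 with ν | ν <;> norm_num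
    rw [hκ]
    refine mul_le_mul_of_nonneg_left (hmono H hH β hβ p q x (Sum.elim (inEdge hx) (outEdge hx) i.2.1, i.1)
      (Sum.elim (inEdge hx) (outEdge hx) i.2.2.1, i.1) (Sum.elim (inEdge hx) (outEdge hx) i.2.2.1, i.2.2.2)
      (Sum.elim (inEdge hx) (outEdge hx) i.2.2.1, i.2.2.2) fun s k => ?_) (by norm_num)
    fin_cases s <;> first | exact abs_signedEdge_base_sub_le_one hx i.2.1 k | exact abs_signedEdge_base_sub_le_one hx i.2.2.1 k
  rw [Finset.sum_const, nsmul_eq_mul]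
  have hcard : ((Finset.univ : Finset (Fin 3 × (Fin 4 ⊕ Fin 4) × (Fin 4 ⊕ Fin 4) × Fin 3)).card : ℝ) = 576 := by simp
  rw [hcard]; ring

/-- ★★ **K3′ row «E1-Φ», `E₀`-EXACT and UNIFORM in the plaquettes**: `|E₀[(L_p − E₀L_p)(L_q − E₀L_q)(Φ₄ − E₀Φ₄)]| ≤ β⁻⁴·C·(1+log H)⁵`
(site rows summed over `interiorSites H ⊆ [0,2H]⁴` with ✓`cubeTwoCentreSums` (2,2): `(1+d)⁻⁶(1+d)⁻⁶, (1+ℓ¹)⁻⁴(1+d)⁻³(1+d)⁻³ ≤ (1+d)⁻²(1+d)⁻²`). -/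
theorem abs_gaussAvg_centred_linCurvSq_linCurvSq_phiQuartic_le : ∃ C : ℝ, 0 ≤ C ∧ ∀ H : ℕ, 1 ≤ H → ∀ β : ℝ, 0 < β → ∀ p q : Plaq 4,
    |gaussAvg β H (fun a => (linCurvSq H p a - gaussAvg β H (linCurvSq H p)) * (linCurvSq H q a - gaussAvg β H (linCurvSq H q)) *
        (phiQuartic H a - gaussAvg β H (phiQuartic H)))| ≤ β⁻¹ ^ 4 * (C * (1 + Real.log H) ^ 5) := by
  obtain ⟨C, hC0, hsite⟩ := abs_conn_phiSite_le
  obtain ⟨Cc, hcube⟩ := cubeTwoCentreSums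
  refine ⟨192 * C * (2 * (2 * max Cc 0)), by positivity, fun H hH β hβ p q => ?_⟩
  have hH1 : (1 : ℝ) ≤ H := by exact_mod_cast hH
  have hL0 : 0 ≤ Real.log (H : ℝ) := Real.log_nonneg hH1
  have hcL : ∀ r : Plaq 4, ∃ Q : MvPolynomial (LandauFree H × Fin 3) ℝ, Q.totalDegree ≤ 2 ∧
      ∀ a, linCurvSq H r a - gaussAvg β H (linCurvSq H r) = MvPolynomial.eval (flatten (LandauFree H) a) Q := fun r =>
    polyCert_sub (EdgeChartGaussian.polyCert_linCurvSq H r) (polyCert_const _ 2)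
  have hW := polyCert_mul (hcL p) (hcL q)
  rw [gaussAvg_mul_centred_eq hβ hW (polyCert_phiQuartic H)]
  rw [show gaussAvg β H (phiQuartic H) = gaussAvg β H (fun a => ∑ x ∈ interiorSites H,
      -(1 / 3 : ℝ) * ∑ c : Fin 3, divLin H x a c * divLin H x (cubeField a) c) from congrArg _ (funext (phiQuartic_eq_sum_sites H))]
  simp_rw [phiQuartic_eq_sum_sites]
  rw [conn_sum_eq hβ (interiorSites H) hW fun x _ => polyCert_phiSite x]
  refine (Finset.abs_sum_le_sum_abs _ _).trans ((Finset.sum_le_sum fun x hx => hsite H hH β hβ p q x hx).trans ?_)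
  -- the two site sums
  have hsub : interiorSites H ⊆ cubeSites (2 * H) := by
    intro x hx
    simp only [interiorSites, cubeSites, Fintype.mem_piFinset, Finset.mem_Icc] at hx ⊢
    intro k
    obtain ⟨h1, h2⟩ := hx k
    exact ⟨by omega, by push_cast; omega⟩
  have h2H : 1 ≤ 2 * H := by omega
  have hlog2H : 1 + Real.log ((2 * H : ℕ) : ℝ) ≤ 2 * (1 + Real.log H) := by
    have hH0 : (0 : ℝ) < H := by linarith
    push_cast
    rw [Real.log_mul (by norm_num) hH0.ne']
    have : Real.log 2 ≤ 1 := by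
      have := Real.log_two_lt_d9; norm_num at this; linarith
    linarith
  have hc1 := (hcube (2 * H) h2H p.1 q.1).1
  have hT : ∀ x : Site 4, 1 / ((1 + siteDist x p.1) ^ 6 * (1 + siteDist x q.1) ^ 6) +
      1 / ((1 + (((∑ m : Fin 4, |p.1 m - q.1 m|) : ℤ) : ℝ)) ^ 4 * (1 + siteDist x p.1) ^ 3 * (1 + siteDist x q.1) ^ 3) ≤
      2 * (1 / ((1 + siteDist x p.1) ^ 2 * (1 + siteDist x q.1) ^ 2)) := by
    intro x
    have ha : 1 ≤ 1 + siteDist x p.1 := by have := GhostKernel.siteDist_nonneg x p.1; linarith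
    have hb : 1 ≤ 1 + siteDist x q.1 := by have := GhostKernel.siteDist_nonneg x q.1; linarith
    have hl : 1 ≤ (1 + (((∑ m : Fin 4, |p.1 m - q.1 m|) : ℤ) : ℝ)) ^ 4 := by
      refine one_le_pow₀ ?_
      have : (0 : ℝ) ≤ (((∑ m : Fin 4, |p.1 m - q.1 m|) : ℤ) : ℝ) := by exact_mod_cast Finset.sum_nonneg fun m _ => abs_nonneg _
      linarith
    have hden : 0 < (1 + siteDist x p.1) ^ 2 * (1 + siteDist x q.1) ^ 2 := by positivity
    have h1 : 1 / ((1 + siteDist x p.1) ^ 6 * (1 + siteDist x q.1) ^ 6) ≤ 1 / ((1 + siteDist x p.1) ^ 2 * (1 + siteDist x q.1) ^ 2) :=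
      one_div_le_one_div_of_le hden (mul_le_mul (pow_le_pow_right₀ ha (by norm_num)) (pow_le_pow_right₀ hb (by norm_num))
        (by positivity) (by positivity))
    have h2 : 1 / ((1 + (((∑ m : Fin 4, |p.1 m - q.1 m|) : ℤ) : ℝ)) ^ 4 * (1 + siteDist x p.1) ^ 3 * (1 + siteDist x q.1) ^ 3) ≤
        1 / ((1 + siteDist x p.1) ^ 2 * (1 + siteDist x q.1) ^ 2) := by
      refine one_div_le_one_div_of_le hden ?_
      calc (1 + siteDist x p.1) ^ 2 * (1 + siteDist x q.1) ^ 2 = 1 * (1 + siteDist x p.1) ^ 2 * (1 + siteDist x q.1) ^ 2 := by ring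
        _ ≤ (1 + (((∑ m : Fin 4, |p.1 m - q.1 m|) : ℤ) : ℝ)) ^ 4 * (1 + siteDist x p.1) ^ 3 * (1 + siteDist x q.1) ^ 3 :=
          mul_le_mul (mul_le_mul hl (pow_le_pow_right₀ ha (by norm_num)) (by positivity) (by positivity))
            (pow_le_pow_right₀ hb (by norm_num)) (by positivity) (by positivity)
    linarith
  have hS : ∑ x ∈ interiorSites H, (1 / ((1 + siteDist x p.1) ^ 6 * (1 + siteDist x q.1) ^ 6) +
      1 / ((1 + (((∑ m : Fin 4, |p.1 m - q.1 m|) : ℤ) : ℝ)) ^ 4 * (1 + siteDist x p.1) ^ 3 * (1 + siteDist x q.1) ^ 3)) ≤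
      2 * (max Cc 0 * (2 * (1 + Real.log H))) := by
    refine (Finset.sum_le_sum fun x _ => hT x).trans ?_
    rw [← Finset.mul_sum]
    refine mul_le_mul_of_nonneg_left ?_ (by norm_num)
    calc ∑ x ∈ interiorSites H, 1 / ((1 + siteDist x p.1) ^ 2 * (1 + siteDist x q.1) ^ 2)
        ≤ ∑ x ∈ cubeSites (2 * H), 1 / ((1 + siteDist x p.1) ^ 2 * (1 + siteDist x q.1) ^ 2) :=
          Finset.sum_le_sum_of_subset_of_nonneg hsub fun x _ _ => by
            have := GhostKernel.siteDist_nonneg x p.1; have := GhostKernel.siteDist_nonneg x q.1; positivity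
      _ ≤ Cc * (1 + Real.log ((2 * H : ℕ) : ℝ)) := hc1
      _ ≤ max Cc 0 * (1 + Real.log ((2 * H : ℕ) : ℝ)) := by
          refine mul_le_mul_of_nonneg_right (le_max_left _ _) ?_
          have : (1 : ℝ) ≤ ((2 * H : ℕ) : ℝ) := by exact_mod_cast h2H
          have := Real.log_nonneg this; linarith
      _ ≤ max Cc 0 * (2 * (1 + Real.log H)) := mul_le_mul_of_nonneg_left hlog2H (le_max_right _ _)
  have hfac : ∀ x : Site 4, 192 * (β⁻¹ ^ 4 * (C * (1 + Real.log H) ^ 4 * (1 / ((1 + siteDist x p.1) ^ 6 * (1 + siteDist x q.1) ^ 6) +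
      1 / ((1 + (((∑ m : Fin 4, |p.1 m - q.1 m|) : ℤ) : ℝ)) ^ 4 * (1 + siteDist x p.1) ^ 3 * (1 + siteDist x q.1) ^ 3)))) =
      (192 * β⁻¹ ^ 4 * C * (1 + Real.log H) ^ 4) * (1 / ((1 + siteDist x p.1) ^ 6 * (1 + siteDist x q.1) ^ 6) +
        1 / ((1 + (((∑ m : Fin 4, |p.1 m - q.1 m|) : ℤ) : ℝ)) ^ 4 * (1 + siteDist x p.1) ^ 3 * (1 + siteDist x q.1) ^ 3)) := fun x => by ring
  simp_rw [hfac]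
  rw [← Finset.mul_sum]
  have hK : 0 ≤ 192 * β⁻¹ ^ 4 * C * (1 + Real.log H) ^ 4 := by positivity
  refine (mul_le_mul_of_nonneg_left hS hK).trans (le_of_eq ?_)
  ring


end PhiQuartic

namespace GaussRestrict

open EdgeChartGaussian (polyCert_const polyCert_sub polyCert_mul polyCert_pow polyCert_linCurvSq gaussAvg_sq_mul_sq_le_of_polyCert
  gaussAvg_centred_linCurvSq_sq_le integrable_polyCert_mul_gaussWeight measurable_linCurvSq)
open LaplaceSandwich (flatten)

/-! ## §6 The row on the cut small-field set `μ_{D′}` -/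

/-- ★★ **K3′ row «E1-Φ» ON THE CUT SET, UNIFORM in the base points**: for `H ≥ 1`, `β > 0`, measurable `D ⊆ smallField H s` (`s ≥ 0`) with
`E₀[1 − 1_D] ≤ τ ≤ 1/2` and all `x y μ₁ ν₁ μ₂ ν₂`,
`|κ₃,₀^{μ_D}(linCurvSq_{(x,μ₁,ν₁)}, linCurvSq_{(y,μ₂,ν₂)}; phiQuartic)| ≤ β⁻¹^4·C·(1+log H)⁵·(1 + √τ·H⁴)`
(the `E₀`-exact row moved onto `μ_D` by fcl-p3 g27's ✓`abs_tiltCum3_muSet_zero_sub_gaussAvg_centred_le`; transfer error `3728·√τ·u²v`,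
`u² = C_V(1+log H)²/β²`, `v = √C_Φ·H⁴(1+log H)²/β²`). -/
theorem abs_tiltCum3_muSet_linCurvSq_linCurvSq_phiQuartic_le : ∃ C : ℝ, 0 ≤ C ∧ ∀ H : ℕ, 1 ≤ H → ∀ β : ℝ, 0 < β →
    ∀ x y : Site 4, ∀ μ₁ ν₁ μ₂ ν₂ : Fin 4, ∀ s : ℝ, 0 ≤ s → ∀ D : Set (LandauFree H → E3), MeasurableSet D → D ⊆ smallField H s →
    ∀ τ : ℝ, gaussAvg β H (fun a => 1 - D.indicator (fun _ => (1 : ℝ)) a) ≤ τ → τ ≤ 1 / 2 →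
    |Tilt.tiltCum3 ((((volume : Measure (LandauFree H → E3)).restrict D).withDensity fun a => ENNReal.ofReal (gaussWeight β H a)))
        (phiQuartic H) 0 (linCurvSq H (x, μ₁, ν₁)) (linCurvSq H (y, μ₂, ν₂))| ≤
      β⁻¹ ^ 4 * (C * (1 + Real.log H) ^ 5 * (1 + Real.sqrt τ * (H : ℝ) ^ 4)) := by
  obtain ⟨C₁, hC₁0, hE⟩ := PhiQuartic.abs_gaussAvg_centred_linCurvSq_linCurvSq_phiQuartic_le
  obtain ⟨CV, hCV0, hV⟩ := gaussAvg_centred_linCurvSq_sq_le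
  obtain ⟨CΦ, hCΦ0, hΦ⟩ := PhiQuartic.gaussAvg_phiQuartic_centred_sq_le
  refine ⟨max C₁ (3728 * CV * Real.sqrt CΦ), le_max_of_le_left hC₁0, fun H hH β hβ x y μ₁ ν₁ μ₂ ν₂ s hs0 D hDm hDs τ hτ hτ2 => ?_⟩
  set p : Plaq 4 := (x, μ₁, ν₁) with hp
  set q : Plaq 4 := (y, μ₂, ν₂) with hq
  have hH1 : (1 : ℝ) ≤ H := by exact_mod_cast hH
  have hL1 : 1 ≤ 1 + Real.log (H : ℝ) := by have h' := Real.log_nonneg hH1; linarith only [h']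
  have hL0 : 0 ≤ 1 + Real.log (H : ℝ) := zero_le_one.trans hL1
  have hH0 : (0 : ℝ) < H := by linarith
  have hW := hE H hH β hβ p q
  have m₁ : Measurable (linCurvSq H p) := measurable_linCurvSq H p
  have m₂ : Measurable (linCurvSq H q) := measurable_linCurvSq H q
  have mP : Measurable (phiQuartic H) := PhiQuartic.measurable_phiQuartic H
  have c₁ := polyCert_linCurvSq H p
  have c₂ := polyCert_linCurvSq H q
  have cP := PhiQuartic.polyCert_phiQuartic H
  have i₁ : Integrable (fun a => linCurvSq H p a ^ 6 * gaussWeight β H a) := integrable_polyCert_mul_gaussWeight H hβ (polyCert_pow c₁ 6)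
  have i₂ : Integrable (fun a => linCurvSq H q a ^ 6 * gaussWeight β H a) := integrable_polyCert_mul_gaussWeight H hβ (polyCert_pow c₂ 6)
  have iP : Integrable (fun a => phiQuartic H a ^ 6 * gaussWeight β H a) := integrable_polyCert_mul_gaussWeight H hβ (polyCert_pow cP 6)
  have hBD0 : 0 ≤ 16 * s ^ 2 + 1024 * (H : ℝ) ^ 4 * s ^ 4 := by positivity
  have hLD : ∀ {z : Site 4} {μ ν : Fin 4}, ∀ a ∈ D, |linCurvSq H (z, μ, ν) a| ≤ 16 * s ^ 2 + 1024 * (H : ℝ) ^ 4 * s ^ 4 := by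
    intro z μ ν a ha
    have h1 := TiltSup.linCurvSq_le hs0 (hDs ha) z μ ν
    have h0 : 0 ≤ linCurvSq H (z, μ, ν) a := Finset.sum_nonneg fun c _ => sq_nonneg _
    rw [abs_of_nonneg h0]
    have : 0 ≤ 1024 * (H : ℝ) ^ 4 * s ^ 4 := by positivity
    linarith
  have hPD : ∀ a ∈ D, |phiQuartic H a| ≤ 16 * s ^ 2 + 1024 * (H : ℝ) ^ 4 * s ^ 4 := fun a ha => by
    have h := PhiQuartic.abs_phiQuartic_le_of_mem_smallField H (hDs ha)
    have : 0 ≤ 16 * s ^ 2 := by positivity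
    linarith
  -- ### the centred Gaussian sizes as perfect squares
  set mp := gaussAvg β H (linCurvSq H p)
  set mq := gaussAvg β H (linCurvSq H q)
  set mM := gaussAvg β H (phiQuartic H)
  have hcL : ∀ r : Plaq 4, ∃ Q : MvPolynomial (LandauFree H × Fin 3) ℝ, Q.totalDegree ≤ 2 ∧
      ∀ a, linCurvSq H r a - gaussAvg β H (linCurvSq H r) = MvPolynomial.eval (flatten (LandauFree H) a) Q := fun r =>
    polyCert_sub (polyCert_linCurvSq H r) (polyCert_const _ 2)
  have hcM : ∃ Q : MvPolynomial (LandauFree H × Fin 3) ℝ, Q.totalDegree ≤ 4 ∧ ∀ a : LandauFree H → E3,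
      phiQuartic H a - mM = MvPolynomial.eval (flatten (LandauFree H) a) Q := polyCert_sub cP (polyCert_const _ 4)
  obtain ⟨u, hu⟩ : ∃ u : ℝ, u = Real.sqrt (CV * (1 + Real.log H) ^ 2 / β ^ 2) := ⟨_, rfl⟩
  obtain ⟨v, hv⟩ : ∃ v : ℝ, v = Real.sqrt (CΦ * (H : ℝ) ^ 8 * (1 + Real.log H) ^ 4 / β ^ 4) := ⟨_, rfl⟩
  have hu0 : 0 ≤ u := by rw [hu]; exact Real.sqrt_nonneg _
  have hv0 : 0 ≤ v := by rw [hv]; exact Real.sqrt_nonneg _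
  have hu2 : u ^ 2 = CV * (1 + Real.log H) ^ 2 / β ^ 2 := by rw [hu]; exact Real.sq_sqrt (by positivity)
  have hv2 : v ^ 2 = CΦ * (H : ℝ) ^ 8 * (1 + Real.log H) ^ 4 / β ^ 4 := by rw [hv]; exact Real.sq_sqrt (by positivity)
  have a₁ : gaussAvg β H (fun a => (linCurvSq H p a - mp) ^ 2) ≤ u ^ 2 := (hV H hH β hβ p).trans (le_of_eq hu2.symm)
  have a₂ : gaussAvg β H (fun a => (linCurvSq H q a - mq) ^ 2) ≤ u ^ 2 := (hV H hH β hβ q).trans (le_of_eq hu2.symm)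
  have a₃ : gaussAvg β H (fun a => (phiQuartic H a - mM) ^ 2) ≤ v ^ 2 := (hΦ H hH β hβ).trans (le_of_eq hv2.symm)
  have n₂ : 0 ≤ gaussAvg β H (fun a => (linCurvSq H q a - mq) ^ 2) := EdgeChartGaussian.gaussAvg_nonneg H hβ fun a => sq_nonneg _
  have n₃ : 0 ≤ gaussAvg β H (fun a => (phiQuartic H a - mM) ^ 2) := EdgeChartGaussian.gaussAvg_nonneg H hβ fun a => sq_nonneg _
  -- Bonami–Nelson products (degrees 2,2 → 81; 2,4 → 729; 4,4 → 6561)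
  have A12 : gaussAvg β H (fun a => ((linCurvSq H p a - mp) * (linCurvSq H q a - mq)) ^ 2) ≤ 81 * (u ^ 2 * u ^ 2) := by
    have h := gaussAvg_sq_mul_sq_le_of_polyCert H hβ (hcL p) (hcL q)
    rw [show ((3 : ℝ) ^ (2 + 2)) = 81 by norm_num, mul_assoc] at h
    refine le_trans (le_of_eq (congrArg _ (funext fun a => by ring))) (h.trans ?_)
    exact mul_le_mul_of_nonneg_left (mul_le_mul a₁ a₂ n₂ (sq_nonneg u)) (by norm_num)
  have A13 : gaussAvg β H (fun a => ((linCurvSq H p a - mp) * (phiQuartic H a - mM)) ^ 2) ≤ 729 * (u ^ 2 * v ^ 2) := by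
    have h := gaussAvg_sq_mul_sq_le_of_polyCert H hβ (hcL p) hcM
    rw [show ((3 : ℝ) ^ (2 + 4)) = 729 by norm_num, mul_assoc] at h
    refine le_trans (le_of_eq (congrArg _ (funext fun a => by ring))) (h.trans ?_)
    exact mul_le_mul_of_nonneg_left (mul_le_mul a₁ a₃ n₃ (sq_nonneg u)) (by norm_num)
  have A23 : gaussAvg β H (fun a => ((linCurvSq H q a - mq) * (phiQuartic H a - mM)) ^ 2) ≤ 729 * (u ^ 2 * v ^ 2) := by
    have h := gaussAvg_sq_mul_sq_le_of_polyCert H hβ (hcL q) hcM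
    rw [show ((3 : ℝ) ^ (2 + 4)) = 729 by norm_num, mul_assoc] at h
    refine le_trans (le_of_eq (congrArg _ (funext fun a => by ring))) (h.trans ?_)
    exact mul_le_mul_of_nonneg_left (mul_le_mul a₂ a₃ n₃ (sq_nonneg u)) (by norm_num)
  have A123 : gaussAvg β H (fun a => ((linCurvSq H p a - mp) * (linCurvSq H q a - mq) * (phiQuartic H a - mM)) ^ 2) ≤
      6561 * (81 * (u ^ 2 * u ^ 2) * v ^ 2) := by
    have h := gaussAvg_sq_mul_sq_le_of_polyCert H hβ (polyCert_mul (hcL p) (hcL q)) hcM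
    rw [show ((3 : ℝ) ^ (2 + 2 + 4)) = 6561 by norm_num, mul_assoc] at h
    refine le_trans (le_of_eq (congrArg _ (funext fun a => by ring))) (h.trans ?_)
    refine mul_le_mul_of_nonneg_left (mul_le_mul A12 a₃ n₃ (mul_nonneg (by norm_num) (mul_nonneg (sq_nonneg u) (sq_nonneg u)))) (by norm_num)
  -- ### the centred transfer
  have key := abs_tiltCum3_muSet_zero_sub_gaussAvg_centred_le hβ hDm hτ hτ2 m₁ m₂ mP hBD0 hLD hLD hPD i₁ i₂ iP
    a₁ a₂ a₃ A12 A13 A23 A123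
  have hτ0 : 0 ≤ Real.sqrt τ := Real.sqrt_nonneg _
  have s1 : Real.sqrt (u ^ 2) = u := Real.sqrt_sq hu0
  have s3 : Real.sqrt (v ^ 2) = v := Real.sqrt_sq hv0
  have s12 : Real.sqrt (81 * (u ^ 2 * u ^ 2)) = 9 * (u * u) := by
    rw [show 81 * (u ^ 2 * u ^ 2) = (9 * (u * u)) ^ 2 by ring]; exact Real.sqrt_sq (mul_nonneg (by norm_num) (mul_nonneg hu0 hu0))
  have s13 : Real.sqrt (729 * (u ^ 2 * v ^ 2)) = 27 * (u * v) := by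
    rw [show 729 * (u ^ 2 * v ^ 2) = (27 * (u * v)) ^ 2 by ring]; exact Real.sqrt_sq (mul_nonneg (by norm_num) (mul_nonneg hu0 hv0))
  have s123 : Real.sqrt (6561 * (81 * (u ^ 2 * u ^ 2) * v ^ 2)) = 729 * (u * u * v) := by
    rw [show 6561 * (81 * (u ^ 2 * u ^ 2) * v ^ 2) = (729 * (u * u * v)) ^ 2 by ring]
    exact Real.sqrt_sq (mul_nonneg (by norm_num) (mul_nonneg (mul_nonneg hu0 hu0) hv0))
  rw [s1, s3, s12, s13, s123] at key
  set κ := Tilt.tiltCum3 ((((volume : Measure (LandauFree H → E3)).restrict D).withDensity fun a => ENNReal.ofReal (gaussWeight β H a)))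
    (phiQuartic H) 0 (linCurvSq H p) (linCurvSq H q)
  set cE := gaussAvg β H (fun a => (linCurvSq H p a - mp) * (linCurvSq H q a - mq) * (phiQuartic H a - mM))
  have hb : |κ - cE| ≤ Real.sqrt τ * (3728 * (u * u * v)) := key.trans (le_of_eq (by ring))
  have htri := abs_sub_abs_le_abs_sub κ cE
  -- ### `u²v` in letters and the final bookkeeping
  have huv : u * u * v = CV * (1 + Real.log H) ^ 2 / β ^ 2 * (Real.sqrt CΦ * ((H : ℝ) ^ 4 * (1 + Real.log H) ^ 2 / β ^ 2)) := by
    rw [← sq, hu2, hv, show CΦ * (H : ℝ) ^ 8 * (1 + Real.log H) ^ 4 / β ^ 4 = CΦ * ((H : ℝ) ^ 4 * (1 + Real.log H) ^ 2 / β ^ 2) ^ 2 by ring,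
      Real.sqrt_mul hCΦ0, Real.sqrt_sq (by positivity)]
  have hβ4 : β⁻¹ ^ 4 = 1 / β ^ 4 := by rw [inv_pow, one_div]
  have hsec : Real.sqrt τ * (3728 * (u * u * v)) ≤ β⁻¹ ^ 4 * (max C₁ (3728 * CV * Real.sqrt CΦ) * (1 + Real.log H) ^ 5 * (Real.sqrt τ * (H : ℝ) ^ 4)) := by
    rw [huv, hβ4]
    have hL45 : (1 + Real.log (H : ℝ)) ^ 4 ≤ (1 + Real.log (H : ℝ)) ^ 5 := pow_le_pow_right₀ hL1 (by norm_num)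
    have hmax : 3728 * CV * Real.sqrt CΦ ≤ max C₁ (3728 * CV * Real.sqrt CΦ) := le_max_right _ _
    have hK0 : 0 ≤ 3728 * CV * Real.sqrt CΦ := by positivity
    have e : Real.sqrt τ * (3728 * (CV * (1 + Real.log H) ^ 2 / β ^ 2 * (Real.sqrt CΦ * ((H : ℝ) ^ 4 * (1 + Real.log H) ^ 2 / β ^ 2)))) =
        1 / β ^ 4 * ((3728 * CV * Real.sqrt CΦ) * (1 + Real.log H) ^ 4 * (Real.sqrt τ * (H : ℝ) ^ 4)) := by
      field_simp
    rw [e]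
    refine mul_le_mul_of_nonneg_left ?_ (by positivity)
    refine mul_le_mul (mul_le_mul hmax hL45 (pow_nonneg hL0 4) (hK0.trans hmax)) le_rfl (by positivity) (by positivity)
  have hfst : β⁻¹ ^ 4 * (C₁ * (1 + Real.log H) ^ 5) ≤ β⁻¹ ^ 4 * (max C₁ (3728 * CV * Real.sqrt CΦ) * (1 + Real.log H) ^ 5) :=
    mul_le_mul_of_nonneg_left (mul_le_mul_of_nonneg_right (le_max_left _ _) (pow_nonneg hL0 5)) (pow_nonneg (inv_nonneg.2 hβ.le) 4)
  rw [show β⁻¹ ^ 4 * (max C₁ (3728 * CV * Real.sqrt CΦ) * (1 + Real.log H) ^ 5 * (1 + Real.sqrt τ * (H : ℝ) ^ 4)) =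
      β⁻¹ ^ 4 * (max C₁ (3728 * CV * Real.sqrt CΦ) * (1 + Real.log H) ^ 5) +
        β⁻¹ ^ 4 * (max C₁ (3728 * CV * Real.sqrt CΦ) * (1 + Real.log H) ^ 5 * (Real.sqrt τ * (H : ℝ) ^ 4)) by ring]
  linarith [hW, hb, htri, hsec, hfst]

/-- **Scaled vertex** (the hK3 row-sum takes `c = −β`): `|κ₃,₀^{μ_D}(linCurvSq, linCurvSq; c·phiQuartic)| ≤ |c|·β⁻¹^4·C·(1+log H)⁵·(1 + √τ·H⁴)`.
At `c = −β` and the exponent point `κ₃ = 1/8 − θ/4` of ASSEMBLY-U5: relative to the floor `40e/H⁸` the `E₀`-part is `H⁸(1+log H)⁵/β` (`[8θ − 1] < 0`)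
and the `√τ`-part `H¹²(1+log H)⁵β^{−1−q/2}` (`τ = β^{−q}`: `[12θ − 1 − q/2] < 0` for `q ≥ 1` on the whole window `θ < 1/10`). -/
theorem abs_tiltCum3_muSet_linCurvSq_linCurvSq_const_mul_phiQuartic_le : ∃ C : ℝ, 0 ≤ C ∧ ∀ H : ℕ, 1 ≤ H → ∀ β : ℝ, 0 < β → ∀ c : ℝ,
    ∀ x y : Site 4, ∀ μ₁ ν₁ μ₂ ν₂ : Fin 4, ∀ s : ℝ, 0 ≤ s → ∀ D : Set (LandauFree H → E3), MeasurableSet D → D ⊆ smallField H s →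
    ∀ τ : ℝ, gaussAvg β H (fun a => 1 - D.indicator (fun _ => (1 : ℝ)) a) ≤ τ → τ ≤ 1 / 2 →
    |Tilt.tiltCum3 ((((volume : Measure (LandauFree H → E3)).restrict D).withDensity fun a => ENNReal.ofReal (gaussWeight β H a)))
        (fun a => c * phiQuartic H a) 0 (linCurvSq H (x, μ₁, ν₁)) (linCurvSq H (y, μ₂, ν₂))| ≤
      |c| * (β⁻¹ ^ 4 * (C * (1 + Real.log H) ^ 5 * (1 + Real.sqrt τ * (H : ℝ) ^ 4))) := by
  obtain ⟨C, hC0, h⟩ := abs_tiltCum3_muSet_linCurvSq_linCurvSq_phiQuartic_le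
  refine ⟨C, hC0, fun H hH β hβ c x y μ₁ ν₁ μ₂ ν₂ s hs0 D hDm hDs τ hτ hτ2 => ?_⟩
  rw [tiltCum3_zero_const_mul_third, abs_mul]
  exact mul_le_mul_of_nonneg_left (h H hH β hβ x y μ₁ ν₁ μ₂ ν₂ s hs0 D hDm hDs τ hτ hτ2) (abs_nonneg c)

end GaussRestrict

end Summit.QuantumFields.YangMills.Theorems.AllWindowsColdBoxBoxHighLine
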